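import Literature.Computability.AlgebraicComplexity.SmallFormatRankProofs
import Literature.Computability.AlgebraicComplexity.SmallFormatRankLaderman
import Literature.Computability.AlgebraicComplexity.SmallFormatMatMulRankUpperPart2
import Literature.Computability.AlgebraicComplexity.SmallFormatMatMulRankUpperPart3
import Literature.Computability.AlgebraicComplexity.SmallFormatMatMulRankUpperPart4
import Literature.Computability.AlgebraicComplexity.MatMulFourRank48Proofs
import Literature.Computability.AlgebraicComplexity.LafonWinogradRankBound
import Literature.Computability.AlgebraicComplexity.MatMulM22RankLowerBoundProofs
import Literature.Computability.AlgebraicComplexity.MatMul2smRankFiniteField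
import HarnessLib

/-!
# ω-census family (a): the kernel-certified rank WINDOWS `lower ≤ R(⟨k,m,n⟩) ≤ upper` for all
formats with dimensions `≤ 5`, over every field (state 2026-08-20; see the 2026-08-21 note below for
`344 / 345 / 455`)

Cell `pub-omega` (HOME `run/shared/lean/pub/pub-omega/`, unit `pub-omega-lit`), topic
`Summits/MatrixMultiplication/OmegaCensus`. Framing (verbatim): lottery ticket; floor = certified
bounds/negative ranges. HONEST FRAMING: this file proves NOTHING new — it assembles, one theorem
per format, the lower and upper bounds that are ALREADY kernel theorems in `Literature/` so that the
census table (`OMEGA-TABLE.md`, 'bound reached (a)') can cite a single declaration per format. Every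
window is a theorem over EVERY field `K` (universe `Type`, as in `blaser2003_thm14`), except that the
upper bounds `48` for `⟨4,4,4⟩` and `32` for `⟨2,4,5⟩` need `2 ≠ 0` in `K` (the published schemes
have coefficients in `ℤ[1/2]`).

Sources of the two ends (all proved in the tree):
* lower: `7 ≤ R(⟨2,2,2⟩)` (Winograd 1971 / Hopcroft–Kerr 1971, `seven_le_tensorRank_matMulTensor_two`);
  Bläser 2003 Thm. 14 / Cor. 9 (`blaser2003_thm14_holds`: `⟨n,m,n⟩ ≥ 2mn+2n−m−2`, `m ≥ n ≥ 3`) for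
  `333, 334, 335, 444, 445, 555`; Lafon–Winograd / BCS 1997 Thm. (17.12) (`LafonWinogradRankBound.lean`)
  for the other thirteen formats;
* 2026-08-21: for `344, 345, 455` the sharper lower ends `28, 34, 46` (Bläser 2003 Thm. 14 plus the
  one-column substitution step `R(⟨c,m,n⟩) + m ≤ R(⟨c,m,n+1⟩)`; = the printed values of Bläser's 1999
  bound `cm + mn + c − m + n − 3` on those cells) are the theorems
  `RankRowIncrement.window_344 / window_345 / window_455` of the sibling file `RankRowIncrement.lean`
  (this file's `window_344 / 345 / 455` keep their original Lafon–Winograd statements `27 / 33 / 44`,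
  which remain true; cite the sibling for the census);
* upper: the explicit published schemes of `SmallFormatRank*.lean`, `SmallFormatMatMulRankUpper*.lean`,
  `MatMulFourRank48Proofs.lean` (Strassen, Hopcroft–Kerr, Laderman, Smirnov, AlphaTensor, AlphaEvolve,
  Sedoglavic–Smirnov, Kauers–Moosbauer, Dumas–Pernet–Sedoglavic, Moosbauer–Poole).

| format | window (every field; `†`: `2 ≠ 0`) | print (best known, any field of char 0) |
|---|---|---|
| 222 | [7, 7] | = 7 |
| 223 | [10, 11]; [11, 11] (`window_223_exact`, 2026-08-22 addendum) | = 11 (Alekseyev 1985) |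
| 224 | [13, 14]; [14, 14] (`window_224_exact`, addendum) | = 14 (Alekseev–Smirnov 2013) |
| 225 | [16, 18]; [17, 18] (`window_225_sharp`, addendum) | [17, 18] (Alekseev 2014) |
| 233 | [14, 15] | [14, 15] |
| 234 | [18, 20] | [18, 20] |
| 235 | [22, 25]; [23, 25] over a field with 2 elements (`window_235_card_two`, addendum) | [22, 25] |
| 244 | [23, 26] | [23, 26] |
| 245 | [28, 32]† | [28, 32] |
| 255 | [34, 40] | [34, 40] |
| 333 | [19, 23] | [19, 23] |
| 334 | [24, 29] | [24, 29] |
| 335 | [29, 36] | [29, 36] |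
| 344 | [27, 38] here; [28, 38] in `RankRowIncrement.window_344` | [28, 38] (Bläser 1999) |
| 345 | [33, 47] here; [34, 47] in `RankRowIncrement.window_345` | [34, 47] (Bläser 1999 at ⟨3,5,4⟩) |
| 355 | [39, 58] | [40, 58] (Bläser 1999) |
| 444 | [34, 48]† | [34, 48] |
| 445 | [41, 61] | [41, 61] |
| 455 | [44, 76] here; [46, 76] in `RankRowIncrement.window_455` | [46, 76] (Bläser 1999) |
| 555 | [53, 93] | [53, 93] |
-/

namespace Summit.MatrixMultiplication.OmegaCensus

open Literature.Computability.AlgebraicComplexity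

namespace RankWindows

variable (K : Type) [Field K]

/-- `R(⟨2,2,2⟩) = 7` over every field. [cite: Winograd1971, Thm 3.1] -/
theorem window_222 : tensorRank (matMulTensor K 2 2 2) ∈ Set.Icc 7 7 :=
  ⟨seven_le_tensorRank_matMulTensor_two K, tensorRank_matMulTensor_two_le_seven K⟩

/-- `10 ≤ R(⟨2,2,3⟩) ≤ 11` over every field. [cite: BurgisserClausenShokrollahi1997, Thm (17.12)] -/
theorem window_223 : tensorRank (matMulTensor K 2 2 3) ∈ Set.Icc 10 11 :=
  ⟨ten_le_tensorRank_matMulTensor_223 K, tensorRank_matMulTensor_223_le K⟩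

/-- `13 ≤ R(⟨2,2,4⟩) ≤ 14` over every field. [cite: BurgisserClausenShokrollahi1997, Thm (17.12)] -/
theorem window_224 : tensorRank (matMulTensor K 2 2 4) ∈ Set.Icc 13 14 :=
  ⟨thirteen_le_tensorRank_matMulTensor_224 K, tensorRank_matMulTensor_224_le K⟩

/-- `16 ≤ R(⟨2,2,5⟩) ≤ 18` over every field. [cite: BurgisserClausenShokrollahi1997, Thm (17.12)] -/
theorem window_225 : tensorRank (matMulTensor K 2 2 5) ∈ Set.Icc 16 18 :=
  ⟨sixteen_le_tensorRank_matMulTensor_225 K, tensorRank_matMulTensor_225_le K⟩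

/-- `14 ≤ R(⟨2,3,3⟩) ≤ 15` over every field. [cite: BurgisserClausenShokrollahi1997, Thm (17.12)] -/
theorem window_233 : tensorRank (matMulTensor K 2 3 3) ∈ Set.Icc 14 15 :=
  ⟨fourteen_le_tensorRank_matMulTensor_233 K, tensorRank_matMulTensor_233_le K⟩

/-- `18 ≤ R(⟨2,3,4⟩) ≤ 20` over every field. [cite: BurgisserClausenShokrollahi1997, Thm (17.12)] -/
theorem window_234 : tensorRank (matMulTensor K 2 3 4) ∈ Set.Icc 18 20 :=
  ⟨eighteen_le_tensorRank_matMulTensor_234 K, tensorRank_matMulTensor_234_le K⟩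

/-- `22 ≤ R(⟨2,3,5⟩) ≤ 25` over every field. [cite: BurgisserClausenShokrollahi1997, Thm (17.12)] -/
theorem window_235 : tensorRank (matMulTensor K 2 3 5) ∈ Set.Icc 22 25 :=
  ⟨twentytwo_le_tensorRank_matMulTensor_235 K, tensorRank_matMulTensor_235_le K⟩

/-- `23 ≤ R(⟨2,4,4⟩) ≤ 26` over every field. [cite: BurgisserClausenShokrollahi1997, Thm (17.12)] -/
theorem window_244 : tensorRank (matMulTensor K 2 4 4) ∈ Set.Icc 23 26 :=
  ⟨twentythree_le_tensorRank_matMulTensor_244 K, tensorRank_matMulTensor_244_le K⟩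

/-- `28 ≤ R(⟨2,4,5⟩) ≤ 32` over every field with `2 ≠ 0` (AlphaEvolve's scheme has coefficients
in `ℤ[1/2]`). [cite: BurgisserClausenShokrollahi1997, Thm (17.12)] -/
theorem window_245 (h2 : (2 : K) ≠ 0) : tensorRank (matMulTensor K 2 4 5) ∈ Set.Icc 28 32 := by
  refine ⟨twentyeight_le_tensorRank_matMulTensor_245 K, tensorRank_matMulTensor_245_le K ?_⟩
  have h8 : ((8 : ℤ) : K) = (2 : K) ^ 3 := by norm_num
  rw [h8]
  exact (isUnit_iff_ne_zero.2 h2).pow 3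

/-- `34 ≤ R(⟨2,5,5⟩) ≤ 40` over every field. [cite: BurgisserClausenShokrollahi1997, Thm (17.12)] -/
theorem window_255 : tensorRank (matMulTensor K 2 5 5) ∈ Set.Icc 34 40 :=
  ⟨thirtyfour_le_tensorRank_matMulTensor_255 K, tensorRank_matMulTensor_255_le K⟩

/-- `19 ≤ R(⟨3,3,3⟩) ≤ 23` over every field (Bläser 2003 Cor. 9; Laderman 1976).
[cite: Blaser2003, Corollary 9] -/
theorem window_333 : tensorRank (matMulTensor K 3 3 3) ∈ Set.Icc 19 23 :=
  ⟨blaser2003_cor9_holds K, tensorRank_matMulTensor_three_le_twentyThree K⟩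

/-- `24 ≤ R(⟨3,3,4⟩) ≤ 29` over every field (Bläser 2003 Thm. 14 at `⟨3,4,3⟩`; Smirnov 2013).
[cite: Blaser2003, Theorem 14] -/
theorem window_334 : tensorRank (matMulTensor K 3 3 4) ∈ Set.Icc 24 29 := by
  refine ⟨?_, tensorRank_matMulTensor_334_le K⟩
  have h := blaser2003_thm14_holds K 4 3 le_rfl (by norm_num)
  rw [tensorRank_matMulTensor_rotate K 3 3 4]
  simpa using h

/-- `29 ≤ R(⟨3,3,5⟩) ≤ 36` over every field (Bläser 2003 Thm. 14 at `⟨3,5,3⟩`; Smirnov 2013).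
[cite: Blaser2003, Theorem 14] -/
theorem window_335 : tensorRank (matMulTensor K 3 3 5) ∈ Set.Icc 29 36 := by
  refine ⟨?_, tensorRank_matMulTensor_335_le K⟩
  have h := blaser2003_thm14_holds K 5 3 le_rfl (by norm_num)
  rw [tensorRank_matMulTensor_rotate K 3 3 5]
  simpa using h

/-- `27 ≤ R(⟨3,4,4⟩) ≤ 38` over every field (Lafon–Winograd; Smirnov 2013). SUPERSEDED for the
census by `RankRowIncrement.window_344` (`[28, 38]`, 2026-08-21); kept as stated.
[cite: BurgisserClausenShokrollahi1997, Thm (17.12)] -/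
theorem window_344 : tensorRank (matMulTensor K 3 4 4) ∈ Set.Icc 27 38 :=
  ⟨twentyseven_le_tensorRank_matMulTensor_344 K, tensorRank_matMulTensor_344_le K⟩

/-- `33 ≤ R(⟨3,4,5⟩) ≤ 47` over every field (Lafon–Winograd at `⟨3,5,4⟩`; AlphaTensor 2022).
SUPERSEDED for the census by `RankRowIncrement.window_345` (`[34, 47]`, 2026-08-21); kept as stated.
[cite: BurgisserClausenShokrollahi1997, Thm (17.12)] -/
theorem window_345 : tensorRank (matMulTensor K 3 4 5) ∈ Set.Icc 33 47 :=
  ⟨thirtythree_le_tensorRank_matMulTensor_345 K, tensorRank_matMulTensor_345_le K⟩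

/-- `39 ≤ R(⟨3,5,5⟩) ≤ 58` over every field (Lafon–Winograd; Sedoglavic–Smirnov 2021).
[cite: BurgisserClausenShokrollahi1997, Thm (17.12)] -/
theorem window_355 : tensorRank (matMulTensor K 3 5 5) ∈ Set.Icc 39 58 :=
  ⟨thirtynine_le_tensorRank_matMulTensor_355 K, tensorRank_matMulTensor_355_le K⟩

/-- `34 ≤ R(⟨4,4,4⟩) ≤ 48` over every field with `2 ≠ 0` (Bläser 2003 Thm. 14; Dumas–Pernet–
Sedoglavic 2025, coefficients in `ℤ[1/2]`). [cite: Blaser2003, Theorem 14] -/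
theorem window_444 (h2 : (2 : K) ≠ 0) : tensorRank (matMulTensor K 4 4 4) ∈ Set.Icc 34 48 := by
  refine ⟨?_, DumasPernetSedoglavic2025_tensorRank_matMulTensor_four_holds K h2⟩
  simpa using blaser2003_thm14_holds K 4 4 (by norm_num) le_rfl

/-- `41 ≤ R(⟨4,4,5⟩) ≤ 61` over every field (Bläser 2003 Thm. 14 at `⟨4,5,4⟩`; AlphaEvolve 2025).
[cite: Blaser2003, Theorem 14] -/
theorem window_445 : tensorRank (matMulTensor K 4 4 5) ∈ Set.Icc 41 61 := by
  refine ⟨?_, tensorRank_matMulTensor_445_le K⟩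
  have h := blaser2003_thm14_holds K 5 4 (by norm_num) (by norm_num)
  rw [tensorRank_matMulTensor_rotate K 4 4 5]
  simpa using h

/-- `44 ≤ R(⟨4,5,5⟩) ≤ 76` over every field (Lafon–Winograd; AlphaTensor 2022). SUPERSEDED for the
census by `RankRowIncrement.window_455` (`[46, 76]`, 2026-08-21); kept as stated.
[cite: BurgisserClausenShokrollahi1997, Thm (17.12)] -/
theorem window_455 : tensorRank (matMulTensor K 4 5 5) ∈ Set.Icc 44 76 :=
  ⟨fortyfour_le_tensorRank_matMulTensor_455 K, tensorRank_matMulTensor_455_le K⟩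

/-- `53 ≤ R(⟨5,5,5⟩) ≤ 93` over every field (Bläser 2003 Thm. 14; Moosbauer–Poole 2025).
[cite: Blaser2003, Theorem 14] -/
theorem window_555 : tensorRank (matMulTensor K 5 5 5) ∈ Set.Icc 53 93 := by
  refine ⟨?_, tensorRank_matMulTensor_555_le K⟩
  simpa using blaser2003_thm14_holds K 5 5 (by norm_num) le_rfl

/-! ## Addendum 2026-08-22 (pub-omega-lit gen 12): the `⟨2,2,n⟩` column at its printed values

Since this file was written (2026-08-20) the tree DISCHARGED Alekseev's theorem
`3m + 2 ≤ R(⟨m,2,2⟩)` (`m ≥ 3`, every field; V. B. Alekseev, Chebyshevskiĭ Sb. 16 (4) (2015) 11–27,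
Thm 1) as `alekseev2015_rank_matMulTensor_m22_ge_holds`
(`Literature/Computability/AlgebraicComplexity/MatMulM22RankLowerBoundProofs.lean`, 2026-08-21), so
the lower ends of the `⟨2,2,n⟩` windows move from Lafon–Winograd's `3n + 1` to the printed exact values:
`R(⟨2,2,3⟩) = 11` (Alekseyev 1985), `R(⟨2,2,4⟩) = 14` (Alekseev–Smirnov 2013), `17 ≤ R(⟨2,2,5⟩) ≤ 18`
(Alekseev 2014/2015; the exact value over a general field is open in print), and in general
`3n + 2 ≤ R(⟨2,2,n⟩) ≤ ⌊(7n+1)/2⌋` for every `n ≥ 3` (upper end Hopcroft–Kerr 1971). Over the field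
with two elements Nazarov 2023 (`8 · R_𝔽₂(⟨2,3,m⟩) ≥ 36 m`, discharged in
`MatMul2smRankFiniteField.lean`) sharpens the `⟨2,3,5⟩` lower end `22 → 23`. As everywhere in this
file: NOTHING new is proved here — each window below is a pair of theorems already in `Literature/`;
the original `window_223 / 224 / 225 / 235` above stay as stated (they remain true). -/

/-- `R(⟨2,2,3⟩) = 11` over every field, as a window `[11, 11]` (Alekseyev 1985; Alekseev 2015 Thm 1
at `m = 3` with Hopcroft–Kerr 1971). [cite: Alekseyev1985, main theorem (zbMATH 0577.68059)] -/
theorem window_223_exact : tensorRank (matMulTensor K 2 2 3) ∈ Set.Icc 11 11 := by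
  rw [alekseyev1985_tensorRank_matMulTensor_223' K]
  exact ⟨le_rfl, le_rfl⟩

/-- `R(⟨2,2,4⟩) = 14` over every field, as a window `[14, 14]` (Alekseev–Smirnov 2013; Alekseev 2015
Thm 1 at `m = 4` with Hopcroft–Kerr 1971). [cite: AlekseevSmirnov2013, Thm 1 (zbMATH 1317.68061)] -/
theorem window_224_exact : tensorRank (matMulTensor K 2 2 4) ∈ Set.Icc 14 14 := by
  rw [alekseevSmirnov2013_tensorRank_matMulTensor_224' K]
  exact ⟨le_rfl, le_rfl⟩

/-- `17 ≤ R(⟨2,2,5⟩) ≤ 18` over every field (Alekseev 2015 Thm 1 at `m = 5`; Hopcroft–Kerr 1971).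
[cite: Alekseev2015ChebyshevM22, Thm 1 and §4] -/
theorem window_225_sharp : tensorRank (matMulTensor K 2 2 5) ∈ Set.Icc 17 18 :=
  alekseev2014_tensorRank_matMulTensor_225_mem_Icc' K

/-- The whole `⟨2,2,n⟩` column: `3n + 2 ≤ R(⟨2,2,n⟩) ≤ ⌊(7n+1)/2⌋` over every field, for every
`n ≥ 3` (Alekseev 2015 Thm 1; Hopcroft–Kerr 1971). [cite: Alekseev2015ChebyshevM22, Thm 1 and §4] -/
theorem window_22n (n : ℕ) (hn : 3 ≤ n) :
    tensorRank (matMulTensor K 2 2 n) ∈ Set.Icc (3 * n + 2) ((7 * n + 1) / 2) :=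
  tensorRank_matMulTensor_22n_mem_Icc' K n hn

/-- `23 ≤ R(⟨2,3,5⟩) ≤ 25` over a field with two elements (Nazarov 2023, Theorem, case `K = 2`,
`n = 2`, `s = 3`, `m = 5`: `2 R ≥ 9 m`; upper end Hopcroft–Kerr 1971 over every field).
[cite: Nazarov2023FiniteFieldLB, Theorem (K = 2, n = 2, s = 3, m = 5)] -/
theorem window_235_card_two (F : Type) [Field F] [Fintype F] (hF : Fintype.card F = 2) :
    tensorRank (matMulTensor F 2 3 5) ∈ Set.Icc 23 25 :=
  ⟨nazarov2023_twentythree_le_tensorRank_matMulTensor_235 F hF, tensorRank_matMulTensor_235_le F⟩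

end RankWindows

end Summit.MatrixMultiplication.OmegaCensus
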